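import Literature.AnabelianGeometry.EtaleTheta.SettingModel
import Literature.AnabelianGeometry.EtaleTheta.Discharge.Sec2DeltaThetaTorsionFree
import HarnessLib

/-!
# A model of the [EtTh] §1 root — the root model carries NO Kummer data (`H¹` has no `2`-torsion there)

Mochizuki, *The étale theta function …*, Publ. RIMS **45** (2009) [EtTh], §1, Prop. 1.5, PRIMS PDF
pp. 22–23 [cite: MochizukiEtTh2009, Prop 1.5 p.23]: "`F² = H¹(G_K, Δ_Θ) →̃ H¹(G_K, Ẑ(1)) →̃ (K^×)^∧`" —
Kummer theory embeds `K^× ⊆ (K^×)^∧` into `H¹((Π^tp_Y)^Θ, Δ_Θ)`; the cell's §1 interface records this as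
the DATA `ThetaSetting.KummerData` (abc-iut-L2-t1, `EtaleThetaClass.lean`: injections
`toKHat : K^× ↪ (K^×)^∧`, `kumY : (K^×)^∧ ↪ H¹((Π^tp_Y)^Θ, Δ_Θ)`, …).

PROOF-ONLY companion (seat abc-iut-w5-d171; abc-iut-L2-lead gen 3 ROW #5-R46 = GAP-LEDGER row G-L2t1-1
«`hL` : log(Ü) has infinite order modulo `F̈²`», census at the root model) to abc-iut-L2-t1's explicit
inhabitant `ThetaSetting.model p` of the root interface (`SettingModel.lean`: `Π^tp_X := F₂ × G_{ℚ_p}`, a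
DIRECT product, discrete). RESULTS:

* `ContH1.eq_one_of_sq_eq_one_of_conj_trivial` (generic) — if `H` acts trivially on the coefficients `A`
  and `A` has no `2`-torsion, then `H¹(H, A)` (`ContH1`: continuous crossed homomorphisms modulo
  principal ones) has no `2`-torsion (cocycles are homomorphisms, coboundaries vanish);
* `ThetaSetting.isEmpty_kummerData_of_conj_eq` (generic `D` under the guard `IsEtThOrigin`) — if
  `(Π^tp_Y)^Θ` CENTRALISES `Δ_Θ` and `K^×` has an element `u ≠ 1` with `u² = 1`, then `D` carries no
  `KummerData` (`Δ_Θ` has no `2`-torsion: abc-iut-L2-t8's `deltaTheta_eq_one_of_sq_eq_one`);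
* `SettingModel.toTheta_conj_eq_of_mem_deltaTheta` — at the root model the WHOLE `(Π^tp_X)^Θ`
  centralises `Δ_Θ` (the Galois factor commutes on the nose, the geometric factor by the root field
  `ker_thetaToEll_central`);
* **`ThetaSetting.model_isEmpty_kummerData : IsEmpty (ThetaSetting.model p).KummerData`** (`−1 ∈ ℚ_p^×`),
  `ThetaSetting.model_isEmpty_etaleThetaData`.

CONSEQUENCE (census token for G-L2t1-1 and the NV-L2 triage): every Kummer-level clause of §1 — Prop.
1.4 (iii), Prop. 1.5 (i)–(iii), standard data, the binder `hL` — is VACUOUS at `ThetaSetting.model p`;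
the root NV model can neither witness nor refute them; they wait for a GENUINE model with non-trivial
cyclotomic action («needs genuine Kummer theory»). HONEST LIMITS: statements about the cell's DEGENERATE
consistency model only; in [EtTh] the action of `G_K` on `Δ_Θ ≅ Ẑ(1)` is the cyclotomic character and
`H¹(G_K, Ẑ(1)) ≅ (K^×)^∧` does carry the torsion `μ(K)`; nothing of [EtTh] is asserted or denied; no
side is taken on [IUTchIII] Cor. 3.12. No definitions, no instances, no Prop facts.
-/

noncomputable section

namespace Literature.AnabelianGeometry.EtaleTheta

open Literature.AnabelianGeometry.SemiGraphs
open scoped IsMulCommutative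

/-! ### Generic: no `2`-torsion in `H¹` for a trivial action on `2`-torsion-free coefficients -/

namespace ContH1

variable {G G' : Type*} [Group G] [TopologicalSpace G]
  [Group G'] [TopologicalSpace G'] [IsTopologicalGroup G']
  {φ : G →* G'} {A : Subgroup G'} [A.Normal] [IsMulCommutative A] {H : Subgroup G}

/-- If `H` acts TRIVIALLY on `A` through `φ` and `A` has no `2`-torsion, then `H¹(H, A)` has no
`2`-torsion: a cocycle `f` with `[f]² = 1` satisfies `f(h)² = ∂a(h) = 1` pointwise, hence `f = 1`.
[cite: NeukirchSchmidtWingberg2008, I §2] -/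
theorem eq_one_of_sq_eq_one_of_conj_trivial
    (htriv : ∀ (h : H) (a : A), MulAut.conjNormal (φ (h : G)) a = a)
    (hA : ∀ a : A, a ^ 2 = 1 → a = 1) (x : ContH1 φ A H) (hx : x ^ 2 = 1) : x = 1 := by
  induction x using QuotientGroup.induction_on with
  | H f =>
    have hf2 : f ^ 2 ∈ (contCoboundaries φ A H).subgroupOf (contCocycles φ A H) := by
      rw [← QuotientGroup.eq_one_iff]
      exact hx
    rw [Subgroup.mem_subgroupOf, mem_contCoboundaries_iff] at hf2
    obtain ⟨a, ha⟩ := hf2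
    have hf1 : f = 1 := by
      apply Subtype.ext
      funext h
      have h1 := congrFun ha h
      rw [htriv h a, mul_inv_cancel] at h1
      have h2 : f.1 h ^ 2 = 1 := by simpa using h1
      simpa using hA _ h2
    rw [hf1]
    rfl

end ContH1

/-! ### Generic: a theta setting whose `(Π^tp_Y)^Θ` centralises `Δ_Θ` carries no Kummer data -/

namespace ThetaSetting

variable {p : ℕ} [Fact p.Prime] (D : ThetaSetting p)

/-- **No `2`-torsion in `H¹(H', Δ_Θ)`** when `H' ≤ (Π^tp_X)^Θ` centralises `Δ_Θ`, under the guard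
`IsEtThOrigin` (`Δ_Θ` torsion-free, abc-iut-L2-t8). [cite: MochizukiEtTh2009, Prop 1.5 p.23] -/
theorem h1Theta_eq_one_of_sq_eq_one_of_conj_eq (hO : D.IsEtThOrigin) (H' : Subgroup D.GtpTheta)
    (htriv : ∀ g ∈ H', ∀ a ∈ D.DeltaTheta, g * a * g⁻¹ = a)
    (c : D.H1Theta H') (hc : c ^ 2 = 1) : c = 1 := by
  refine ContH1.eq_one_of_sq_eq_one_of_conj_trivial (fun h a => ?_) (fun a ha => ?_) c hc
  · apply Subtype.ext
    rw [MulAut.conjNormal_apply, MonoidHom.id_apply]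
    exact htriv h.1 h.2 a.1 a.2
  · apply Subtype.ext
    have h2 : (a : D.GtpTheta) ^ 2 = 1 := by
      have := congrArg Subtype.val ha
      simpa using this
    exact D.deltaTheta_eq_one_of_sq_eq_one hO a.2 h2

/-- **A theta setting whose `(Π^tp_Y)^Θ` centralises `Δ_Θ` carries NO Kummer data** as soon as `K^×` has
an element `u ≠ 1` with `u² = 1` (e.g. `−1`): `u` would inject through `toKHat ≫ kumY` to a `2`-torsion
class of `H¹((Π^tp_Y)^Θ, Δ_Θ)`. [cite: MochizukiEtTh2009, Prop 1.5 p.23] -/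
theorem isEmpty_kummerData_of_conj_eq (hO : D.IsEtThOrigin)
    (htriv : ∀ g ∈ D.GtpY.map D.toTheta, ∀ a ∈ D.DeltaTheta, g * a * g⁻¹ = a)
    (u : (↥D.K)ˣ) (hu : u ≠ 1) (hu2 : u ^ 2 = 1) : IsEmpty D.KummerData := by
  refine ⟨fun E => hu ?_⟩
  have hc : (E.kumY (E.toKHat u)) ^ 2 = 1 := by
    rw [← map_pow, ← map_pow, hu2, map_one, map_one]
  have hc1 := D.h1Theta_eq_one_of_sq_eq_one_of_conj_eq hO _ htriv _ hc
  exact E.toKHat_injective (E.kumY_injective (by rw [hc1, map_one, map_one]))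

end ThetaSetting

/-! ### The root model -/

namespace SettingModel

variable (p : ℕ) [Fact p.Prime]

/-- A lift to `Π^tp_X = Δ × Γ` of an element of `Δ_Θ` has trivial Galois component.
[cite: MochizukiEtTh2009, §1 p.12] -/
theorem snd_eq_one_of_mk_mem_deltaTheta {y : PiTp p}
    (hy : (toThetaM p y) ∈ (ThetaSetting.model p).DeltaTheta) : y.2 = 1 := by
  have hy' : y ∈ KEll p := (mk_mem_ker_thetaToEllM_iff p y).mp hy
  have h2 := snd_eq_one_of_mem_deltaHat p (toHat_mem_deltaHat_of_mem_KEll p hy')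
  have h3 : etaGam p y.2 = 1 := h2
  exact etaGam_injective p (by rw [h3, map_one])

/-- **At the root model the whole `(Π^tp_X)^Θ` centralises `Δ_Θ`**: `Π^tp_X = Δ × Γ` is a direct
product, so conjugation by `(d, γ)` on a lift `(e, 1)` of an element of `Δ_Θ` is conjugation by the
geometric element `(d, 1)`, which acts trivially by the root field `ker_thetaToEll_central` ("`Δ_Θ` is
central in `(Δ^tp_X)^Θ`", p. 12). [cite: MochizukiEtTh2009, §1 p.12] -/
theorem toTheta_conj_eq_of_mem_deltaTheta (g a : (ThetaSetting.model p).GtpTheta)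
    (ha : a ∈ (ThetaSetting.model p).DeltaTheta) : g * a * g⁻¹ = a := by
  obtain ⟨x, rfl⟩ := QuotientGroup.mk_surjective g
  obtain ⟨y, rfl⟩ := QuotientGroup.mk_surjective a
  have hy2 : y.2 = 1 := snd_eq_one_of_mk_mem_deltaTheta p ha
  -- the geometric part `x' = (x.1, 1)` of `x`
  have hconj : x * y * x⁻¹ = ((x.1, 1) : PiTp p) * y * ((x.1, 1) : PiTp p)⁻¹ := by
    ext
    · simp
    · simp [hy2]
  have hx'Δ : ((x.1, 1) : PiTp p) ∈ (curve p).aug.toMonoidHom.ker := (mem_deltaTemp_iff p _).mpr rfl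
  -- centrality of `Δ_Θ` in `(Δ^tp_X)^Θ`
  have hcen := ker_thetaToEllM_central p (y : GTheta p) ha (((x.1, 1) : PiTp p) : GTheta p)
    ⟨((x.1, 1) : PiTp p), hx'Δ, rfl⟩
  show (((x * y * x⁻¹ : PiTp p)) : GTheta p) = (y : GTheta p)
  rw [hconj, QuotientGroup.mk_mul, QuotientGroup.mk_mul, QuotientGroup.mk_inv, ← hcen,
    mul_inv_cancel_right]

/-- `−1 ≠ 1` in `K^×` for the base field `K = ℚ_p ⊆ ℚ̄_p` of the root model (characteristic `0`).
[folklore] -/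
private theorem neg_one_ne_one_units : (-1 : (↥(ThetaSetting.model p).K)ˣ) ≠ 1 := by
  intro h
  have h1 : ((-1 : (↥(ThetaSetting.model p).K)ˣ) : ↥(ThetaSetting.model p).K) = 1 := by
    rw [h, Units.val_one]
  rw [Units.val_neg, Units.val_one] at h1
  have h2 : ((ThetaSetting.model p).K.val) (-1) = ((ThetaSetting.model p).K.val) 1 := by rw [h1]
  rw [map_neg, map_one] at h2
  haveI : CharZero (PadicAlgCl p) :=
    charZero_of_injective_algebraMap (algebraMap ℚ_[p] (PadicAlgCl p)).injective
  have h3 : (2 : PadicAlgCl p) = 0 := by linear_combination -h2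
  exact two_ne_zero h3

/-- **The root model carries no Kummer data**: `K^× = ℚ_p^× ∋ −1` has an element of order `2`, which the
injections `toKHat`, `kumY` of any `KummerData` would carry to a `2`-torsion element of
`H¹((Π^tp_Y)^Θ, Δ_Θ)` — there is none at the root model, where `(Π^tp_X)^Θ` centralises `Δ_Θ`. So every
Kummer-level clause of §1 (Prop. 1.4 (iii), Prop. 1.5 (i)–(iii), the G-L2t1-1 binder `hL`, standard data)
is VACUOUS at `ThetaSetting.model p` and waits for a genuine model with non-trivial cyclotomic action.
[cite: MochizukiEtTh2009, Prop 1.5 p.23] -/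
theorem _root_.Literature.AnabelianGeometry.EtaleTheta.ThetaSetting.model_isEmpty_kummerData :
    IsEmpty (ThetaSetting.model p).KummerData :=
  (ThetaSetting.model p).isEmpty_kummerData_of_conj_eq (ThetaSetting.model_isEtThOrigin p)
    (fun g _ a ha => toTheta_conj_eq_of_mem_deltaTheta p g a ha) (-1) (neg_one_ne_one_units p)
    neg_one_sq

/-- Hence no étale theta data over the root model either (`EtaleThetaData` extends `KummerData`).
[cite: MochizukiEtTh2009, Prop 1.3 p.20] -/
theorem _root_.Literature.AnabelianGeometry.EtaleTheta.ThetaSetting.model_isEmpty_etaleThetaData :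
    IsEmpty (ThetaSetting.model p).EtaleThetaData :=
  ⟨fun E => (ThetaSetting.model_isEmpty_kummerData p).false E.toKummerData⟩

/-- No Kummer data over the root model, `Nonempty` form (census token «KummerData: 0 producers at the root
model, certified»). [cite: MochizukiEtTh2009, Prop 1.5 p.23] -/
theorem _root_.Literature.AnabelianGeometry.EtaleTheta.ThetaSetting.model_not_nonempty_kummerData :
    ¬ Nonempty (ThetaSetting.model p).KummerData :=
  not_nonempty_iff.mpr (ThetaSetting.model_isEmpty_kummerData p)

end SettingModel

end Literature.AnabelianGeometry.EtaleTheta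

end
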